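import Summits.ResolutionOfSingularities.ResolutionOfSingularities.Theorems.PlanarSectionLiftClasses
import Literature.AlgebraicGeometry.Resolution.PointBlowupFlagLostComponents
import Literature.AlgebraicGeometry.Resolution.PointBlowupFlagDropMonomialStep
import Literature.AlgebraicGeometry.Resolution.PointBlowupFlagTranslatedStep
import Literature.AlgebraicGeometry.Resolution.PointBlowupFlagTangentStep
import Literature.AlgebraicGeometry.Resolution.DiffOpFrobeniusLinear
import Literature.AlgebraicGeometry.Resolution.HasseSchmidtDiffEqDiffOp
import Mathlib.RingTheory.PowerSeries.Basic
import Mathlib.RingTheory.PowerSeries.Order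
import Mathlib.RingTheory.MvPowerSeries.Trunc
import Mathlib.RingTheory.PowerSeries.Inverse
import Mathlib.Algebra.CharP.Lemmas
import Mathlib.FieldTheory.IsAlgClosed.AlgebraicClosure
import HarnessLib

/-!
# PlanarCurveTrapQPow — decomp-res node «CurveTrap» (lens-5 g26, critic row 177 CLEARED DECIDED +1), tree file 1/7 of the node

Content VERBATIM from the decomp-res lens-5 g26 node `HOME/decomp-res-lens-5/g26/CurveTrap.lean` (pin 39d382f9, 1529
l, 85 declarations §E–§J, 0 sorry, std axioms;
HOME = run/shared/lean/pub/decomp-res): the node imports the LANDED tree only (`Theorems/PlanarSectionLiftClasses` +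
Literature `PointBlowupFlag{LostComponents,
DropMonomialStep,TranslatedStep,TangentStep}` / `DiffOpFrobeniusLinear` / `HasseSchmidtDiffEqDiffOp` + Mathlib power
series) and carries nothing.  Critic: CRITIC-LEDGER
row 177 CLEARED DECIDED +1 (window row 172, lens-5 g26, item (T-1′) LOW-EMPTY CLASS:
`SectionLift.NoLowEmptyIsolatedSectionTailsDeep` PROVED outright in kernel, hypothesis-free, by
genuine two-letter laws over K̄ — CURVE LAW + TRAP LAW with the (a,b) ↦ (a, a+b−q) clock — then dropped from the
node equation EXACTLY).  Landing orders NODE §8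
(lens rider INBOX :838) endorsed by the critic INBOX :842: namespace `…Theorems.CurveTrap`, `--kind proof --supports
stmt-ResolutionOfSingularities-31770`, FOUR
chain-imported files cut at the node's section banners — `PlanarCurveTrapQPow` (§E+§F) · `PlanarCurveTrapForms` (§G)
· `PlanarCurveTrapEngine` (§H) · `PlanarCurveTrap`
(§I+§J) — each continued `…2` where the tree's 400-line cap cuts; headers from the node's §-paragraphs; the node's
`set_option linter.dupNamespace false` line DROPPED as for
every landed node (the library sets it; writer tree files carry no `set_option linter.…`).  Column bookkeeping
(route MaxContactCut, lens-5): the live planar aside is RE-INFORMALLED to «= the g24 terminal leaf exactly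
(`CurveTrap.terminal_iff_lowLive`) = `SectionLift.NoLowLiveTerminalSectionPlanarTailsDeep`; low-empty half PROVED
EMPTY (`CurveTrap.noLowEmptyIsolatedSectionTailsDeep_holds`)»
— the `SectionLift` / `CurveTrap` modules sit in the Theses import cone (they import `PlanarSectionLiftClasses` ⊇ …
⊇ `Theses.MaxContactCut`), so the successor
class cannot be typed as a route aside decl without an import cycle; the proved class is NOT filed as an item.

The lens header, verbatim:

> CurveTrap
> # CurveTrap — decomp-res node (lens-5 g26, critic row 172 (T-1′)): the LOW-EMPTY terminal class is EMPTY (PROVED)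
>
> decomp-res ROOT DECOMPOSITION CELL, lens «finite/base range + asymptotic regime + bridge», generation 26.
> HOME = run/shared/lean/pub/decomp-res; this file = `HOME/decomp-res-lens-5/g26/CurveTrap.lean` (the pinned node).
> Namespace `…Theorems.CurveTrap`; imports the LANDED g25 node (`Theorems.PlanarSectionLift{,Classes}`, namespace
> `…Theorems.SectionLift`) and reaches the host target `MaxContactCut.DefectWalksDeep` (stmt 31770) BY NAME through
> `SectionLift.closes_sectionLift`.  `--supports stmt-ResolutionOfSingularities-31770`; in the Theses cone.
>
> ## Result (binding window g26, CRITIC-LEDGER row 172 (T-1′): "+1 when `NoLowEmptyIsolatedSectionTailsDeep` is PROVED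
> outright in kernel (hyp-free, then DROPPED from the node equation, exact) by genuine two-letter laws over K̄ — CURVE
> LAW + TRAP LAW (move clock (a,b) ↦ (a, a+b−q))")
>
> * **`noLowEmptyIsolatedSectionTailsDeep_holds : SectionLift.NoLowEmptyIsolatedSectionTailsDeep`** — PROVED, 0 sorry,
>   hypothesis-free (§J).
> * **`defectWalksDeep_iff_curveTrap`** — THE NODE EQUATION, exact, the low-empty class DROPPED:
>   `MaxContactCut.DefectWalksDeep ↔ NoFreePointTailsDeep ∧ (NoNonTerminalSectionPlanarJointTailsDeep ∧
>   NoLowLiveTerminalSectionPlanarTailsDeep) ∧ StallVertex.NoPositiveSkewStalledTailsDeep ∧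
>   StallVertex.NoNullFlatSkewStalledTailsDeep`; `terminal_iff_lowLive` (the g24 terminal leaf `=` the low-live class).
> * **`closes_curveTrap`** `(hA : NoFreePointTailsDeep) (hP3 : HP24Prop3) (hP4 : HP24Prop4)
>   (hL : NoLowLiveTerminalSectionPlanarTailsDeep) (hR : NoSkewJointTailsDeep) : MaxContactCut.DefectWalksDeep` and
>   `closes_curveTrap_leaves` (skew leaves) — 31770 BY NAME.
>
> ## The proof (all over `L = K̄`, two letters; [HP24] = HauserPerlega2024)
>
> §E `S_q` = the `q`-power-supported series (`IsQPow`): an algebra closed under the cleaning, `q`-th powers and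
> substitutions (what the cleaning removes and what a change of subordinate parameters does to it).
> §F two letters: the MOVE MAP `Ψ_{x,t} : X_x ↦ X_x, X_y ↦ X_x (X_y + t)` and the BRIDGE to the tree's move:
> `X_x^q · ↑(pointTransform q x b s) = Ψ_{x, b y}(↑s.F)` (`X_pow_mul_coe_pointTransform`, from the tree's
> `translate_chartTransform_eq_chartTransform_shear`, `X_pow_mul_coe_chartTransform`, `substFree_smul_X_eq_coe`).
> §G the TRAP DATUM = CURVE FORM `G = X_m^b · W^a · U + S_q` (`U` unit, `W(0) = 0`, `W` REGULAR IN THE OTHER LETTER: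
> `[X_n] W ≠ 0` — no Weierstrass preparation is ever made) and the END FORM `X^β · V + S_q`; the ORDER LAW
> (`X_m^b X_n^a ∈ supp G`, so `a + b ≥ ord G`); the STEP LAWS = the MOVE CLOCK: under `Ψ_{m,t}` curve form persists with
> `(a, b) ↦ (a, a + b − q)` or ends as `X_m^{a+b−q} V`; under `Ψ_{n,t}` it persists WITH THE LETTERS SWAPPED and the same
> clock, or ends as `X^β V`, `β_n = a + b − q`; END FORM ⇒ the `h = 0` MONOMIAL CASE of [HP24] §3 after cleaning.
> §H the ISOLATION ENGINE (CURVE LAW): the ARC CRITERION (`not_isolatedTop_of_arc`, g25 `extra/CurveLawKit` verbatim: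
> an arc through the origin killing `J_G = (∂^{(α)} G : 0 < |α| < q)` makes the origin a non-isolated top point), the
> `q`-power linearity of Hasse derivatives (tree `IsDiffOpLE.apply_pow_char_pow_mul'`), degree congruences via Mathlib
> `MvPowerSeries.truncTotal`, and the APPROXIMATE-ARC ENGINE `not_isolatedTop_of_approx` (polynomial approximants + arc
> congruences mod `T^M`), whence ISO-1 `↑G = X_i^q R + S_q ⇒ ¬ IsolatedTop` and ISO-2
> `↑G = (X_c + h(X_o))^q R + S_q ⇒ ¬ IsolatedTop` (the approximate arcs `X_o ↦ T, X_c ↦ −h_{<n}(T)`).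
> §I START: a terminal flag `⟨c, o, h⟩` ([HP24] §3: monomial case / small residual case of the expansion in the
> subordinate parameters `y + h(x)`) at an ISOLATED top point with all monomials of degree `≥ q + 1` puts `↑G` in curve
> form with `W = X_c + h(X_o)`, `1 ≤ a < q` (every other terminal shape is ISO-1, ISO-2, or has a monomial of degree `< q`).
> §J the TRAP ON THE WALK: END LAW (an end form after a move is a fat point — excluded by the class binder (I) — or an
> `h = 0` monomial flag — excluded by the class binder (G)), the section's move read on series (tree `secState_step_F` +
> §F bridge + `coe_deletePthPowers`), DESCENT by strong induction on the clock `b` (`a + b − q < b` as `a < q`), START at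
> the terminal time `t₀ ≥ N` given by binder (T).  Binders (L) and `LowEmpty` of the class are not used (they were
> consumed by g25 to produce (I) and (G)).
>
> DECIDED-IN-TREE (used BY NAME, never restated): `HauserPerlega2024.{IsTerminalGiven, IsMonomialCase,
> IsSmallResidualCase, IsTerminalSub, FlagDatum.expansion, excLetters, cleanSeries, divMonomial, coeff_cleanSeries,
> hasSubst_shift, subst_shift_zero, subst_shift_subst_shift, substFree_eq_subst, coe_deletePthPowers,
> translate_chartTransform_eq_chartTransform_shear, X_pow_mul_coe_chartTransform, substFree_smul_X_eq_coe}`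
> (`PointBlowupFlag{Invariant,MaximalShift,ShiftBound,TangentStep,TranslatedStep,LostComponents}`), `Hauser2010.{ordZero,
> deletePthPowers, IsPthPowerExponent}`, `PointBlowup.{step, pointTransform, newMult}`, `PlanarPort.{secState, secState_step_F,
> excLetters_secState_step, secState_clean, le_degree_of_mem_support_secState, idx, secPt, Kbar, ι}`,
> `SectionLift.{expansion_of_h_zero, defectWalksDeep_iff_sectionLift, closes_sectionLift, terminal_iff_lowEmpty_lowLive,
> lowEmptyTerminal_iff_isolatedSection}`, `PlanarCut.fin3_cases`, `ProximityCut.le_degree_of_mem_support`,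
> `ItineraryCutClasses.{walk_ord, walk_clean}`, `TightDefectClasses.{IsolatedTop, topIdeal, ForcedWalk, IsRoot}`,
> `Literature…{hasseDeriv, coeff_hasseDeriv, isDiffOpLE_hasseDeriv, IsDiffOpLE.apply_pow_char_pow_mul',
> hasseDeriv_monomial_eq_zero_of_not_le, coeff_eq_zero_of_degree_lt_ordZero, exists_ordZero_eq_natCast}`.
>
> (Sources: HauserPerlega2024 (Publ. RIMS 60: §2 p. 774, §3 p. 775, §4 p. 779, §5 p. 783, §7 p. 788, Prop. 3 proof
> p. 792); Hauser2010Kangaroo §§F–G; Perlega2017 (arXiv:2011.14443) §7.3; BenitoVillamayor2012 §4 (top locus via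
> differential operators); Villamayor2008 §2.6; Giraud1975 / AbadVillamayor (q-power linearity of differential operators of
> order < q); ZariskiSamuel1960 Vol. II Ch. VII §1 (formal power series, substitution).)
>

## This file

§E `q`-POWER-SUPPORTED SERIES `S_q` (the part of an expansion the cleaning removes) — `section QPow`: `IsQPow q Q := ∀ d, coeff d Q ≠ 0 → ∀ i, q ∣ d i` (untagged `def : Prop`, the tree's `LowEmpty` convention), ring closure, the CLEANING splits a series as clean + `S_q` (`isQPow_sub_cleanSeries`, `IsQPow.cleanSeries_eq_zero`, `cleanSeries_add'`), Frobenius (`isQPow_coe_pow_char_pow`, `isQPow_pow_char_pow`: `f^q ∈ S_q` for every SERIES `f`), substitution (`IsQPow.subst`); §F TWO LETTERS — `section TwoLetters`: the plateau move as ONE substitution `moveMap n m t` (= `X_n ↦ X_n, X_m ↦ X_n (X_m + t)`, support def), its substitution API, and THE BRIDGE `X_pow_mul_coe_pointTransform`: `X_x^q · ↑(pointTransform q x b s) = subst (moveMap x y (b y)) ↑s.F` — the tree's move read on series (continued `…2` where the 400-line cap cuts).  (This first part carries: `IsQPow`, `IsQPow.coeff_eq_zero`, `isQPow_zero`, `IsQPow.add`,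 `IsQPow.neg`, `IsQPow.sub`, `IsQPow.mul`, `isQPow_monomial`, `isQPow_C`, `isQPow_one`, `IsQPow.pow`, `IsQPow.sum`, `IsQPow.prod`, `IsQPow.of_monomial_mul`, `isQPow_sub_cleanSeries`, `IsQPow.cleanSeries_eq_zero`, `cleanSeries_add'`, `cleanSeries_cleanSeries'`, `isQPow_coe_pow_char_pow`, `isQPow_pow_char_pow`, `IsQPow.subst`, `finsupp_ext_two`.)

[WRITER NOTE (decomp-res writer g11): file split only (tree files ≤ 400 lines); namespace, sections, section
variables, the `open` block and every
declaration exactly as in the lens (the node's global dupNamespace-linter line is dropped — the library sets it);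
ONE deletion (gate dedup
rule, critic :842 watch-list): the node's copy `eq_single_add_single_two` is NOT re-landed — it is LITERALLY the landed
`HauserPerlega2024.finsupp_eq_single_add_single` (`PointBlowupFlagTranslatedStep`, imported; namespace opened as in
the lens), cited by name at its two uses; no instance, no notation, no include/omit added.]

(Sources: HauserPerlega2024 (characteristic-free resolution of surfaces by point blowups: Props. 3–4, the monomial
case); Hauser2010 Lectures VII–IX; CossartJannsenSaito2020 Ch. 5; Moh1987; BenitoVillamayor2014; the Hasse–Schmidt /
point-blowup flag formalism of the tree (Literature PointBlowupFlag*).)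
-/

open MvPolynomial Finset
open Literature.AlgebraicGeometry.Resolution
open Literature.AlgebraicGeometry.Resolution.Hauser2010
open Literature.AlgebraicGeometry.Resolution.HauserPerlega2024
open Literature.AlgebraicGeometry.Resolution.PointBlowup
open Literature.AlgebraicGeometry.Resolution.WeightedBlowup
open Summit.ResolutionOfSingularities.ResolutionOfSingularities.Theses
open Summit.ResolutionOfSingularities.ResolutionOfSingularities.Theorems.TightDefectClasses
open Summit.ResolutionOfSingularities.ResolutionOfSingularities.Theorems.TightDefectStrongWalks
open Summit.ResolutionOfSingularities.ResolutionOfSingularities.Theorems.ItineraryCutClasses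
open Summit.ResolutionOfSingularities.ResolutionOfSingularities.Theorems.ProximityCut
open Summit.ResolutionOfSingularities.ResolutionOfSingularities.Theorems.ExitLaw
open Summit.ResolutionOfSingularities.ResolutionOfSingularities.Theorems.PlanarCut
open Summit.ResolutionOfSingularities.ResolutionOfSingularities.Theorems.CoefficientCut
open Summit.ResolutionOfSingularities.ResolutionOfSingularities.Theorems.PlanarPort
open Summit.ResolutionOfSingularities.ResolutionOfSingularities.Theorems.SectionLift

namespace Summit.ResolutionOfSingularities.ResolutionOfSingularities.Theorems.CurveTrap

section QPow

variable {σ : Type*} {L : Type*} [Field L]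

/-! ## §E `q`-power-supported series `S_q` (the part of an expansion the cleaning removes) -/

/-- `S_q`: a power series whose non-zero coefficients all sit at `q`-divisible exponents (over a perfect field of
characteristic `p`, `q = pᵉ`: exactly the `q`-th powers).  DEFINITION (support). -/
def IsQPow (q : ℕ) (Q : MvPowerSeries σ L) : Prop :=
  ∀ d : σ →₀ ℕ, MvPowerSeries.coeff d Q ≠ 0 → ∀ i, q ∣ d i

/-- [folklore] -/
theorem IsQPow.coeff_eq_zero {q : ℕ} {Q : MvPowerSeries σ L} (hQ : IsQPow q Q) {d : σ →₀ ℕ} {i : σ}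
    (h : ¬ q ∣ d i) : MvPowerSeries.coeff d Q = 0 := by
  by_contra hne
  exact h (hQ d hne i)

/-- [folklore] -/
theorem isQPow_zero (q : ℕ) : IsQPow q (0 : MvPowerSeries σ L) := fun _ hd => absurd (map_zero _) hd

/-- [folklore] -/
theorem IsQPow.add {q : ℕ} {Q R : MvPowerSeries σ L} (hQ : IsQPow q Q) (hR : IsQPow q R) : IsQPow q (Q + R) := by
  intro d hd i
  rw [map_add] at hd
  by_cases h : MvPowerSeries.coeff d Q = 0
  · rw [h, zero_add] at hd
    exact hR d hd i
  · exact hQ d h i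

/-- [folklore] -/
theorem IsQPow.neg {q : ℕ} {Q : MvPowerSeries σ L} (hQ : IsQPow q Q) : IsQPow q (-Q) :=
  fun d hd i => hQ d (by rwa [map_neg, neg_ne_zero] at hd) i

/-- [folklore] -/
theorem IsQPow.sub {q : ℕ} {Q R : MvPowerSeries σ L} (hQ : IsQPow q Q) (hR : IsQPow q R) : IsQPow q (Q - R) := by
  rw [sub_eq_add_neg]
  exact hQ.add hR.neg

/-- [folklore] -/
theorem IsQPow.mul {q : ℕ} {Q R : MvPowerSeries σ L} (hQ : IsQPow q Q) (hR : IsQPow q R) : IsQPow q (Q * R) := by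
  classical
  intro d hd i
  rw [MvPowerSeries.coeff_mul] at hd
  obtain ⟨uv, huv, hne⟩ := Finset.exists_ne_zero_of_sum_ne_zero hd
  rw [Finset.HasAntidiagonal.mem_antidiagonal] at huv
  have hu : MvPowerSeries.coeff uv.1 Q ≠ 0 := fun h => hne (by rw [h, zero_mul])
  have hv : MvPowerSeries.coeff uv.2 R ≠ 0 := fun h => hne (by rw [h, mul_zero])
  rw [← huv, Finsupp.add_apply]
  exact dvd_add (hQ _ hu i) (hR _ hv i)

/-- [folklore] -/
theorem isQPow_monomial (q : ℕ) {m : σ →₀ ℕ} (hm : ∀ i, q ∣ m i) (a : L) :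
    IsQPow q (MvPowerSeries.monomial m a) := by
  classical
  intro d hd i
  rw [MvPowerSeries.coeff_monomial] at hd
  split_ifs at hd with h
  · rw [h]; exact hm i
  · exact absurd rfl hd

/-- [folklore] -/
theorem isQPow_C (q : ℕ) (a : L) : IsQPow q (MvPowerSeries.C a : MvPowerSeries σ L) := by
  rw [← MvPowerSeries.monomial_zero_eq_C_apply]
  exact isQPow_monomial q (fun i => by simp) a

/-- [folklore] -/
theorem isQPow_one (q : ℕ) : IsQPow q (1 : MvPowerSeries σ L) := by
  rw [← map_one (MvPowerSeries.C (σ := σ) (R := L))]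
  exact isQPow_C q 1

/-- [folklore] -/
theorem IsQPow.pow {q : ℕ} {Q : MvPowerSeries σ L} (hQ : IsQPow q Q) : ∀ n : ℕ, IsQPow q (Q ^ n)
  | 0 => by rw [pow_zero]; exact isQPow_one q
  | n + 1 => by rw [pow_succ]; exact (hQ.pow n).mul hQ

/-- [folklore] -/
theorem IsQPow.sum {ι : Type*} {q : ℕ} (s : Finset ι) (f : ι → MvPowerSeries σ L)
    (h : ∀ i ∈ s, IsQPow q (f i)) : IsQPow q (∑ i ∈ s, f i) := by
  classical
  induction s using Finset.induction_on with
  | empty => rw [Finset.sum_empty]; exact isQPow_zero q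
  | insert a s ha ih =>
    rw [Finset.sum_insert ha]
    exact (h a (Finset.mem_insert_self a s)).add (ih fun i hi => h i (Finset.mem_insert_of_mem hi))

/-- [folklore] -/
theorem IsQPow.prod {ι : Type*} {q : ℕ} (s : Finset ι) (f : ι → MvPowerSeries σ L)
    (h : ∀ i ∈ s, IsQPow q (f i)) : IsQPow q (∏ i ∈ s, f i) := by
  classical
  induction s using Finset.induction_on with
  | empty => rw [Finset.prod_empty]; exact isQPow_one q
  | insert a s ha ih =>
    rw [Finset.prod_insert ha]
    exact (h a (Finset.mem_insert_self a s)).mul (ih fun i hi => h i (Finset.mem_insert_of_mem hi))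

/-- Dividing by a `q`-power monomial keeps `S_q`. [folklore] -/
theorem IsQPow.of_monomial_mul {q : ℕ} {m : σ →₀ ℕ} (hm : ∀ i, q ∣ m i) {f : MvPowerSeries σ L}
    (h : IsQPow q (MvPowerSeries.monomial m 1 * f)) : IsQPow q f := by
  classical
  intro d hd i
  have h1 : MvPowerSeries.coeff (d + m) (MvPowerSeries.monomial m 1 * f) = MvPowerSeries.coeff d f := by
    rw [MvPowerSeries.coeff_monomial_mul, if_pos le_add_self, one_mul, add_tsub_cancel_right]
  have h2 := h (d + m) (by rw [h1]; exact hd) i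
  rw [Finsupp.add_apply, add_comm] at h2
  exact (Nat.dvd_add_right (hm i)).mp h2

/-- The part of a series removed by the cleaning lies in `S_q`. [folklore] -/
theorem isQPow_sub_cleanSeries (q : ℕ) (H : MvPowerSeries σ L) : IsQPow q (H - cleanSeries q H) := by
  classical
  intro d hd i
  rw [map_sub, coeff_cleanSeries] at hd
  by_cases h : ∀ i, q ∣ d i
  · exact h i
  · rw [if_neg h, sub_self] at hd
    exact absurd rfl hd

/-- The cleaning kills `S_q` (for `q ≠ 0`... in fact always: an exponent that is not `q`-divisible carries `0`). [folklore] -/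
theorem IsQPow.cleanSeries_eq_zero {q : ℕ} {Q : MvPowerSeries σ L} (hQ : IsQPow q Q) : cleanSeries q Q = 0 := by
  classical
  refine MvPowerSeries.ext fun d => ?_
  rw [coeff_cleanSeries, map_zero]
  split_ifs with h
  · rfl
  · push Not at h
    obtain ⟨i, hi⟩ := h
    exact hQ.coeff_eq_zero hi

/-- The cleaning is additive. [folklore] -/
theorem cleanSeries_add' (q : ℕ) (A B : MvPowerSeries σ L) :
    cleanSeries q (A + B) = cleanSeries q A + cleanSeries q B := by
  classical
  refine MvPowerSeries.ext fun d => ?_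
  simp only [coeff_cleanSeries, map_add]
  split_ifs <;> simp

/-- The cleaning is idempotent. [folklore] -/
theorem cleanSeries_cleanSeries' (q : ℕ) (A : MvPowerSeries σ L) :
    cleanSeries q (cleanSeries q A) = cleanSeries q A := by
  classical
  refine MvPowerSeries.ext fun d => ?_
  simp only [coeff_cleanSeries]
  split_ifs <;> simp

variable (p : ℕ) [Fact p.Prime] [CharP L p]

/-- **Frobenius, polynomials:** `P^{pᵉ}` is `pᵉ`-power supported. [folklore] -/
theorem isQPow_coe_pow_char_pow (e : ℕ) (P : MvPolynomial σ L) :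
    IsQPow (p ^ e) (((P ^ p ^ e : MvPolynomial σ L)) : MvPowerSeries σ L) := by
  classical
  induction P using MvPolynomial.induction_on with
  | C a =>
    rw [← map_pow, MvPolynomial.coe_C]
    exact isQPow_C _ _
  | add P Q hP hQ =>
    rw [add_pow_char_pow P Q p e, MvPolynomial.coe_add]
    exact hP.add hQ
  | mul_X P i hP =>
    rw [mul_pow, MvPolynomial.coe_mul, MvPolynomial.coe_pow (φ := X i), MvPolynomial.coe_X, MvPowerSeries.X_pow_eq]
    refine hP.mul (isQPow_monomial _ (fun l => ?_) 1)
    rw [Finsupp.single_apply]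
    split_ifs
    · exact dvd_rfl
    · exact dvd_zero _

/-- **Frobenius, power series:** `f^{pᵉ}` is `pᵉ`-power supported (its coefficient at `d` is that of the `pᵉ`-th power
of the polynomial truncation of `f` at `d`). [folklore] -/
theorem isQPow_pow_char_pow (e : ℕ) (f : MvPowerSeries σ L) : IsQPow (p ^ e) (f ^ p ^ e) := by
  classical
  haveI : CharP (MvPowerSeries σ L) p := charP_of_injective_ringHom (MvPowerSeries.C_injective (σ := σ) (R := L)) p
  intro d hd i
  set T : MvPolynomial σ L := MvPowerSeries.trunc' L d f with hT
  set r : MvPowerSeries σ L := f - (T : MvPowerSeries σ L) with hr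
  have hrc : ∀ m, m ≤ d → MvPowerSeries.coeff m r = 0 := fun m hm => by
    rw [hr, map_sub, MvPolynomial.coeff_coe, hT, MvPowerSeries.coeff_trunc', if_pos hm, sub_self]
  have hf : f = (T : MvPowerSeries σ L) + r := by rw [hr]; ring
  have hq : 0 < p ^ e := pow_pos (Fact.out : p.Prime).pos e
  have hrq : MvPowerSeries.coeff d (r ^ p ^ e) = 0 := by
    obtain ⟨n, hn⟩ : ∃ n, p ^ e = n + 1 := ⟨p ^ e - 1, by omega⟩
    rw [hn, pow_succ, MvPowerSeries.coeff_mul]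
    refine Finset.sum_eq_zero fun uv huv => ?_
    rw [Finset.HasAntidiagonal.mem_antidiagonal] at huv
    rw [hrc uv.2 (by rw [← huv]; exact le_add_self), mul_zero]
  rw [hf, add_pow_char_pow _ _ p e, map_add, hrq, add_zero, ← MvPolynomial.coe_pow] at hd
  exact isQPow_coe_pow_char_pow p e T d hd i

/-- **`S_q` is stable under every substitution** (each `q`-power monomial goes to a `q`-th power). [folklore] -/
theorem IsQPow.subst [Fintype σ] {τ : Type*} {a : σ → MvPowerSeries τ L} (ha : MvPowerSeries.HasSubst a) (e : ℕ)
    {Q : MvPowerSeries σ L} (hQ : IsQPow (p ^ e) Q) : IsQPow (p ^ e) (MvPowerSeries.subst a Q) := by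
  classical
  have hq : 0 < p ^ e := pow_pos (Fact.out : p.Prime).pos e
  intro d hd i
  rw [MvPowerSeries.coeff_subst ha] at hd
  obtain ⟨m, hm⟩ : ∃ m : σ →₀ ℕ,
      MvPowerSeries.coeff m Q • MvPowerSeries.coeff d (m.prod fun s n => a s ^ n) ≠ 0 := by
    by_contra h
    push Not at h
    exact hd (finsum_eq_zero_of_forall_eq_zero h)
  have hmQ : MvPowerSeries.coeff m Q ≠ 0 := fun h => hm (by rw [h, zero_smul])
  have hmc : MvPowerSeries.coeff d (m.prod fun s n => a s ^ n) ≠ 0 := fun h => hm (by rw [h, smul_zero])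
  obtain ⟨m', hm'⟩ : ∃ m' : σ →₀ ℕ, m = (p ^ e) • m' := by
    refine ⟨Finsupp.mapRange (fun n => n / p ^ e) (by simp) m, ?_⟩
    ext s
    obtain ⟨c, hc⟩ := hQ m hmQ s
    simp [hc, Nat.mul_div_cancel_left c hq]
  have hprod : (m.prod fun s n => a s ^ n) = (m'.prod fun s n => a s ^ n) ^ p ^ e := by
    rw [Finsupp.prod_pow, Finsupp.prod_pow, ← Finset.prod_pow]
    refine Finset.prod_congr rfl fun s _ => ?_
    rw [hm', Finsupp.smul_apply, smul_eq_mul, mul_comm, pow_mul]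
  rw [hprod] at hmc
  exact isQPow_pow_char_pow p e _ d hmc i

end QPow

section TwoLetters

variable {σ : Type*} [DecidableEq σ] {L : Type*} [Field L]

/-! ## §F Two letters: the plateau move as ONE substitution `Ψ_{x,t} : X_x ↦ X_x, X_y ↦ X_x (X_y + t)` -/

omit [DecidableEq σ] in
/-- Two-letter exponents are determined by their two values. [folklore] -/
theorem finsupp_ext_two {x y : σ} (hσ : ∀ l, l = x ∨ l = y) {d d' : σ →₀ ℕ} (hx : d x = d' x) (hy : d y = d' y) :
    d = d' := by
  ext l
  rcases hσ l with rfl | rfl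
  · exact hx
  · exact hy

end TwoLetters

end Summit.ResolutionOfSingularities.ResolutionOfSingularities.Theorems.CurveTrap
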